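import Literature.Analysis.FluidPDE.DuchonRobertDefectZeroOfBesov
import Literature.Barriers.AnomalousDissipation.CodimensionOneRigidityAlberti
import Literature.Barriers.AnomalousDissipation.CodimensionOneRigidityStructure
import HarnessLib

/-!
# The dualised `BV` increment estimate and Ambrosio's structure bound for the defect

Support file for the discharge of the named fact
`Literature.Barriers.AnomalousDissipation.DeRosaInversi2024_thm12` (`CodimensionOneRigidity.lean`),
in two parts (De Rosa–Inversi 2024, Lemma 2.2 and §4).

## Part 1 (`section Duality`): the `BV` increment estimate by duality (op. cit., Lemma 2.2)

De Rosa–Inversi, Lemma 2.2 (`BV` increment estimate): `∫_A |f(x + εz) - f(x)| dx ≤ ε |z·∇f|((A)_ε)`,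
proved there for smooth `f` by the fundamental theorem of calculus along the segment and then by
density. Here the field `w` is only bounded and measurable, its gradient being available solely
through the representation `-∫∫ ζ ⟪e, w⟫ Dφ z = ∫ φ ⟪e, M z⟫ dμ` of
`CodimensionOneRigidityStructure`; accordingly the estimate is proved **by duality**
(`integral_abs_inner_increment_mul_le`): for a continuous compactly supported weight `Θ ≥ 0`,

`∫ |ζ(t) ⟪e, w(t, x + εz) - w(t, x)⟫| Θ(t, x) dx dt
   ≤ ε ∫₀¹ ∫ Θ(t, x - sεz) |⟪e, M(t,x) z⟫| dμ(t,x) ds`,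

in three steps: (i) the identity `∫ ζ ⟪e, δ_{εz} w⟫ φ = ε ∫₀¹ ∫ φ(t, x - sεz) ⟪e, M z⟫ dμ ds` for
smooth `φ` (translation invariance of Haar measure on `T^d`, the fundamental theorem of calculus
`φ(x - εz) - φ(x) = -ε ∫₀¹ Dφ(x - sεz) z ds`, Fubini, and the representation applied to the
translates of `φ`) — `integral_mul_inner_increment_mul_eq`; (ii) its consequence for `|φ| ≤ Θ + η`;
(iii) a density argument producing smooth `φ` with `|φ| ≤ Θ + η` and `∫ F φ ≥ ∫ |F| Θ - η`
(Mathlib's `Integrable.exists_boundedContinuous_integral_sub_le` for the measure `|F| dx dt`,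
clamping, and `exists_smooth_near`) — `exists_smooth_integral_mul_ge`. Everything is proved;
theorems only.

## Part 2 (`section FluxBound`): Ambrosio's structure bound for the defect (op. cit., §4)

The estimate (1.9)/§4 of De Rosa–Inversi 2024,
`|⟨D[u], ψ⟩| ≲ ‖u‖²_∞ ∫ (∫ |∇ρ(z) · M_{x,t} z| dz) |ψ| dν`, in the tree's Duchon–Robert vocabulary
(`abs_defect_le`): if `D` is a Duchon–Robert defect of `u` (`Torus.HasDuchonRobertDefect T u D`),
`w` is a bounded (`‖w‖ ≤ Mbd`) strongly measurable representative of `u` on `[a, b] × T^d`, and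
`(μ, M)` represent the cut-off gradient `ζ ∂ⱼwᵢ = Mᵢⱼ μ` as in `exists_density`, then for every
test function `θ` supported in time where `ζ = 1`, every continuous compactly supported
`Θ ≥ |θ|` and every mollifier `ρ`,

`|D θ| ≤ Mbd² ∫ (∫ |Dρ(z)(M(t,x) z)| dz) Θ(t,x) dμ`.

Proof (op. cit. §4, first display, then Lemma 2.2): rescale `D_ε(w) = (4ε)⁻¹ ∫ ⟪∇ρ(z), δ_{εz}w⟫
|δ_{εz}w|² dz`, bound `|δw|² ≤ 4 Mbd²`, exchange the integrals (Tonelli, in `ℝ≥0∞`), apply the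
dualised `BV` increment estimate `integral_abs_inner_increment_mul_le` at each `z`, and let
`ε → 0⁺` by dominated convergence (continuity of `Θ`); the pairings `∫₀ᵀ∫ D_ε(u) θ` converge to
`D θ` by definition of the defect, and do not see the difference between `u` and `w`.
Everything is proved; theorems only.

## References

* L. De Rosa, M. Inversi, Comm. Math. Phys. 405 (2024), (1.9), Lemma 2.2, §4 (arXiv:2307.09189).
* J. Duchon, R. Robert, Nonlinearity 13 (2000), (9), Prop. 2.
-/

noncomputable section

namespace Literature.Barriers.AnomalousDissipation

namespace CodimensionOneRigidity

section Duality

open MeasureTheory TopologicalSpace Set Function Filter Topology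
open scoped ENNReal NNReal RealInnerProductSpace ContDiff BoundedContinuousFunction

open Literature.Analysis Literature.Analysis.FunctionSpaces Literature.Analysis.FluidPDE

variable {d : Type} [Fintype d] [DecidableEq d]

/-! ### Integrability on space–time of bounded functions with compact time support -/

omit [DecidableEq d] in
/-- A bounded a.e.-strongly measurable function on `ℝ × T^d` vanishing outside a time slab is
integrable. [folklore] -/
theorem integrable_of_bound_of_time_support {G : ℝ × UnitAddTorus d → ℝ}
    (hG : AEStronglyMeasurable G volume) {C a b : ℝ} (hGC : ∀ q, ‖G q‖ ≤ C)
    (hG0 : ∀ q : ℝ × UnitAddTorus d, q.1 ∉ Icc a b → G q = 0) : Integrable G volume := by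
  refine IntegrableOn.integrable_of_forall_notMem_eq_zero
    (s := Icc a b ×ˢ (univ : Set (UnitAddTorus d))) ?_ fun q hq => hG0 q fun h => hq ⟨h, mem_univ _⟩
  refine IntegrableOn.of_bound ?_ hG.restrict C (ae_of_all _ hGC)
  rw [Measure.volume_eq_prod, Measure.prod_prod]
  exact ENNReal.mul_lt_top measure_Icc_lt_top (measure_lt_top _ _)

/-! ### Translates of smooth space–time functions -/

omit [DecidableEq d] in
/-- Spatial translates of smooth space–time functions are smooth. [folklore] -/
theorem contDiff_stLift_translate {φ : ℝ → UnitAddTorus d → ℝ} (hφ : ContDiff ℝ ∞ (Torus.stLift φ))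
    (v : EuclideanSpace ℝ d) :
    ContDiff ℝ ∞ (Torus.stLift fun t x => φ t (x - Torus.proj v)) := by
  have h : Torus.stLift (fun t x => φ t (x - Torus.proj v)) =
      Torus.stLift φ ∘ fun p : ℝ × EuclideanSpace ℝ d => (p.1, p.2 - v) := by
    funext p
    rfl
  rw [h]
  exact hφ.comp (contDiff_fst.prodMk (contDiff_snd.sub contDiff_const))

omit [Fintype d] [DecidableEq d] in
/-- The torus derivative commutes with translations: `D(f(· - c))(x) = Df(x - c)`. [folklore] -/
theorem torusFderiv_translate (f : UnitAddTorus d → ℝ) (c x : UnitAddTorus d) :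
    Torus.fderiv (fun y => f (y - c)) x = Torus.fderiv f (x - c) := by
  unfold Torus.fderiv
  congr 1
  funext v
  show f (x + Torus.proj v - c) = f (x - c + Torus.proj v)
  rw [add_sub_right_comm]

omit [DecidableEq d] in
/-- **Fundamental theorem of calculus along a segment on the torus**:
`f(x + v) - f(x) = ∫₀¹ Df(x + sv) v ds` for `C¹` `f` (De Rosa–Inversi 2024, proof of Lemma 2.2,
first display). [cite: DeRosaInversi2024, Lemma 2.2] -/
theorem sub_eq_integral_fderiv {f : UnitAddTorus d → ℝ} (hf : Torus.IsSmooth f) (x : UnitAddTorus d)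
    (v : EuclideanSpace ℝ d) :
    f (x + Torus.proj v) - f x = ∫ s in (0 : ℝ)..1, Torus.fderiv f (x + Torus.proj (s • v)) v := by
  have hf1 : Torus.IsContDiff 1 f := hf.isContDiff (by simp)
  have hderiv : ∀ s : ℝ, HasDerivAt (fun s : ℝ => f (x + Torus.proj (s • v)))
      (Torus.fderiv f (x + Torus.proj (s • v)) v) s := fun s => by
    have h := Torus.hasDerivAt_comp_add_proj_smul hf1 x v s
    rwa [Torus.lineDeriv_eq_fderiv_apply hf1] at h
  have hcont : Continuous fun s : ℝ => Torus.fderiv f (x + Torus.proj (s • v)) v := by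
    obtain ⟨x₀, rfl⟩ := Torus.proj_surjective x
    have h : (fun s : ℝ => Torus.fderiv f (Torus.proj x₀ + Torus.proj (s • v)) v) =
        fun s => fderiv ℝ (Torus.lift f) (x₀ + s • v) v := by
      funext s
      rw [← Torus.proj_add, ← Torus.fderiv_lift]
    rw [h]
    exact ((hf1.continuous_fderiv one_ne_zero).comp (continuous_const.add
      (continuous_id.smul continuous_const))).clm_apply continuous_const
  rw [intervalIntegral.integral_eq_sub_of_hasDerivAt (fun s _ => hderiv s)
    (hcont.intervalIntegrable 0 1)]
  simp

omit [DecidableEq d] in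
/-- **The increment of a smooth function along `-εz`**:
`φ(x - εz) - φ(x) = -ε ∫₀¹ Dφ(x - sεz) z ds`. [cite: DeRosaInversi2024, Lemma 2.2] -/
theorem sub_eq_neg_mul_integral_fderiv {f : UnitAddTorus d → ℝ} (hf : Torus.IsSmooth f)
    (x : UnitAddTorus d) (z : EuclideanSpace ℝ d) (ε : ℝ) :
    f (x - Torus.proj (ε • z)) - f x =
      -ε * ∫ s in (0 : ℝ)..1, Torus.fderiv f (x - Torus.proj ((s * ε) • z)) z := by
  have h := sub_eq_integral_fderiv hf x (-(ε • z))
  rw [Torus.proj_neg, ← sub_eq_add_neg] at h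
  rw [h, ← intervalIntegral.integral_const_mul]
  refine intervalIntegral.integral_congr fun s _ => ?_
  simp only [smul_neg, Torus.proj_neg, ← sub_eq_add_neg, map_neg, map_smul, smul_eq_mul, smul_smul]
  ring

/-! ### The duality identity `∫ ζ ⟪e, δ_{εz}w⟫ φ = ε ∫₀¹ ∫ φ(· - sεz) ⟪e, Mz⟫ dμ ds` -/

section Identity

variable {w : ℝ → UnitAddTorus d → EuclideanSpace ℝ d} {Mbd : ℝ} {ζ : ℝ → ℝ} {a b : ℝ}
  {μ : Measure (ℝ × UnitAddTorus d)}
  {M : ℝ × UnitAddTorus d → EuclideanSpace ℝ d →L[ℝ] EuclideanSpace ℝ d}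

omit [DecidableEq d] in
/-- `q ↦ ⟪e, w q⟫` is strongly measurable for a jointly strongly measurable field. [folklore] -/
theorem stronglyMeasurable_inner_uncurry (hw : StronglyMeasurable (uncurry w))
    (e : EuclideanSpace ℝ d) :
    StronglyMeasurable fun q : ℝ × UnitAddTorus d => ⟪e, w q.1 q.2⟫ :=
  (continuous_const.inner continuous_id).comp_stronglyMeasurable hw

omit [DecidableEq d] in
/-- The spatial directional derivative of a smooth space–time function is jointly continuous and
bounded on `[a, b] × T^d`. [folklore] -/
theorem continuous_fderiv_slice_apply {φ : ℝ → UnitAddTorus d → ℝ}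
    (hφ : ContDiff ℝ ∞ (Torus.stLift φ)) (z : EuclideanSpace ℝ d) (a b : ℝ) :
    Continuous (uncurry fun t x => Torus.fderiv (φ t) x z) ∧
      ∃ C : ℝ, ∀ t ∈ Icc a b, ∀ x, ‖Torus.fderiv (φ t) x z‖ ≤ C := by
  have hst := Torus.isSmoothSpaceTimeOn_of_contDiff hφ univ
  have hld := hst.lineDeriv uniqueDiffOn_univ z
  have heq : (fun t x => Torus.lineDeriv (φ t) x z) = fun t x => Torus.fderiv (φ t) x z := by
    funext t x
    exact Torus.lineDeriv_eq_fderiv_apply ((isSmooth_slice hφ t).isContDiff (by simp)) x z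
  rw [heq] at hld
  refine ⟨?_, hld.exists_norm_le_of_isCompact isCompact_Icc (subset_univ _)⟩
  have h := hld.continuousOn_stLift
  rw [univ_prod_univ, continuousOn_univ] at h
  exact Torus.continuous_uncurry_of_continuous_stLift h

omit [DecidableEq d] in
/-- **The duality identity** (the smooth case of De Rosa–Inversi 2024, Lemma 2.2, tested against
`φ` and with the gradient replaced by its representation): for smooth `φ` vanishing outside a
compact time interval,
`∫ ζ(t) ⟪e, w(t, x + εz) - w(t, x)⟫ φ(t, x) dx dt = ε ∫₀¹ ∫ φ(t, x - sεz) ⟪e, M(t,x) z⟫ dμ ds`. [cite: DeRosaInversi2024, Lemma 2.2] -/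
theorem integral_mul_inner_increment_mul_eq (hw : StronglyMeasurable (uncurry w))
    (hwb : ∀ t x, ‖w t x‖ ≤ Mbd) (hζc : Continuous ζ) (hζ1 : ∀ t, |ζ t| ≤ 1)
    (hζ0 : ∀ t ∉ Icc a b, ζ t = 0)
    (hrep : ∀ φ : ℝ → UnitAddTorus d → ℝ, ContDiff ℝ ∞ (Torus.stLift φ) →
      (∃ a' b' : ℝ, ∀ t ∉ Icc a' b', φ t = 0) → ∀ e z : EuclideanSpace ℝ d,
        -∫ t, ∫ x, ζ t * (⟪e, w t x⟫ * Torus.fderiv (φ t) x z) =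
          ∫ q, φ q.1 q.2 * ⟪e, M q z⟫ ∂μ)
    {φ : ℝ → UnitAddTorus d → ℝ} (hφ : ContDiff ℝ ∞ (Torus.stLift φ))
    (hφsupp : ∃ a' b' : ℝ, ∀ t ∉ Icc a' b', φ t = 0) (e z : EuclideanSpace ℝ d) (ε : ℝ) :
    ∫ q : ℝ × UnitAddTorus d, ζ q.1 * ⟪e, w q.1 (q.2 + Torus.proj (ε • z)) - w q.1 q.2⟫ * φ q.1 q.2 =
      ε * ∫ s in Icc (0 : ℝ) 1, ∫ q, φ q.1 (q.2 - Torus.proj ((s * ε) • z)) * ⟪e, M q z⟫ ∂μ := by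
  have hMbd : 0 ≤ Mbd := (norm_nonneg _).trans (hwb 0 0)
  set p : UnitAddTorus d := Torus.proj (ε • z) with hp
  obtain ⟨hφc, Cφ, hCφ⟩ := continuous_uncurry_and_bounded hφ hφsupp.choose_spec.choose_spec
  obtain ⟨hDc, CD₀, hCD₀⟩ := continuous_fderiv_slice_apply hφ z a b
  set CD : ℝ := max CD₀ 0 with hCDdef
  have hCD0 : 0 ≤ CD := le_max_right _ _
  have hCD : ∀ t ∈ Icc a b, ∀ x, ‖Torus.fderiv (φ t) x z‖ ≤ CD := fun t ht x =>
    (hCD₀ t ht x).trans (le_max_left _ _)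
  have hiw := stronglyMeasurable_inner_uncurry hw e
  -- pointwise bounds
  have hζq : ∀ q : ℝ × UnitAddTorus d, ‖ζ q.1‖ ≤ 1 := fun q => by
    rw [Real.norm_eq_abs]; exact hζ1 q.1
  have hwq : ∀ (t : ℝ) (x : UnitAddTorus d), ‖⟪e, w t x⟫‖ ≤ ‖e‖ * Mbd := fun t x =>
    (norm_inner_le_norm _ _).trans (mul_le_mul_of_nonneg_left (hwb t x) (norm_nonneg _))
  -- the three integrands
  set G₁ : ℝ × UnitAddTorus d → ℝ := fun q => ζ q.1 * ⟪e, w q.1 (q.2 + p)⟫ * φ q.1 q.2 with hG₁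
  set G₂ : ℝ × UnitAddTorus d → ℝ := fun q => ζ q.1 * ⟪e, w q.1 q.2⟫ * φ q.1 q.2 with hG₂
  set G₃ : ℝ × UnitAddTorus d → ℝ := fun q => ζ q.1 * ⟪e, w q.1 q.2⟫ * φ q.1 (q.2 - p) with hG₃
  have hshift : Measurable fun q : ℝ × UnitAddTorus d => (q.1, q.2 + p) :=
    measurable_fst.prodMk (measurable_snd.add_const p)
  have hshift' : Measurable fun q : ℝ × UnitAddTorus d => (q.1, q.2 - p) :=
    measurable_fst.prodMk (measurable_snd.sub_const p)
  have hm₁ : AEStronglyMeasurable G₁ volume :=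
    (((hζc.comp continuous_fst).stronglyMeasurable.mul (hiw.comp_measurable hshift)).mul
      hφc.stronglyMeasurable).aestronglyMeasurable
  have hm₂ : AEStronglyMeasurable G₂ volume :=
    (((hζc.comp continuous_fst).stronglyMeasurable.mul hiw).mul
      hφc.stronglyMeasurable).aestronglyMeasurable
  have hm₃ : AEStronglyMeasurable G₃ volume :=
    (((hζc.comp continuous_fst).stronglyMeasurable.mul hiw).mul
      (hφc.stronglyMeasurable.comp_measurable hshift')).aestronglyMeasurable
  have hbound : ∀ (t : ℝ) (x y : UnitAddTorus d), ‖ζ t * ⟪e, w t x⟫ * φ t y‖ ≤ 1 * (‖e‖ * Mbd) * Cφ := by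
    intro t x y
    rw [norm_mul, norm_mul]
    exact mul_le_mul (mul_le_mul (hζq (t, x)) (hwq t x) (norm_nonneg _) zero_le_one)
      (hCφ (t, y)) (norm_nonneg _) (by positivity)
  have hi₁ : Integrable G₁ volume := integrable_of_bound_of_time_support (a := a) (b := b) hm₁
    (fun q => hbound q.1 _ _) fun q hq => by simp only [hG₁, hζ0 q.1 hq, zero_mul]
  have hi₂ : Integrable G₂ volume := integrable_of_bound_of_time_support (a := a) (b := b) hm₂
    (fun q => hbound q.1 _ _) fun q hq => by simp only [hG₂, hζ0 q.1 hq, zero_mul]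
  have hi₃ : Integrable G₃ volume := integrable_of_bound_of_time_support (a := a) (b := b) hm₃
    (fun q => hbound q.1 _ _) fun q hq => by simp only [hG₃, hζ0 q.1 hq, zero_mul]
  -- (i) split and translate
  have hsplit : ∫ q : ℝ × UnitAddTorus d, ζ q.1 * ⟪e, w q.1 (q.2 + p) - w q.1 q.2⟫ * φ q.1 q.2 =
      (∫ q, G₁ q) - ∫ q, G₂ q := by
    rw [← integral_sub hi₁ hi₂]
    refine integral_congr_ae (ae_of_all _ fun q => ?_)
    simp only [hG₁, hG₂, inner_sub_right]
    ring
  have htrans : ∫ q, G₁ q = ∫ q, G₃ q := by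
    have hi₁' := hi₁
    have hi₃' := hi₃
    rw [Measure.volume_eq_prod] at hi₁' hi₃' ⊢
    rw [integral_prod _ hi₁', integral_prod _ hi₃']
    refine integral_congr_ae (ae_of_all _ fun t => ?_)
    dsimp only
    have h := integral_add_right_eq_self (μ := (volume : Measure (UnitAddTorus d)))
      (fun x => G₃ (t, x)) p
    rw [← h]
    refine integral_congr_ae (ae_of_all _ fun x => ?_)
    simp only [hG₁, hG₃, add_sub_cancel_right]
  -- (ii) the fundamental theorem of calculus inside
  set T : (ℝ × UnitAddTorus d) × ℝ → ℝ := fun r =>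
    Torus.fderiv (φ r.1.1) (r.1.2 - Torus.proj ((r.2 * ε) • z)) z with hT
  have hTc : Continuous T := by
    have h : T = (uncurry fun t x => Torus.fderiv (φ t) x z) ∘
        fun r : (ℝ × UnitAddTorus d) × ℝ => (r.1.1, r.1.2 - Torus.proj ((r.2 * ε) • z)) := by
      funext r; rfl
    rw [h]
    refine hDc.comp ?_
    exact (continuous_fst.comp continuous_fst).prodMk ((continuous_snd.comp continuous_fst).sub
      (Torus.continuous_proj.comp ((continuous_snd.mul continuous_const).smul continuous_const)))
  set H : (ℝ × UnitAddTorus d) × ℝ → ℝ := fun r => ζ r.1.1 * ⟪e, w r.1.1 r.1.2⟫ * T r with hH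
  have hFTC : ∀ q : ℝ × UnitAddTorus d, G₃ q - G₂ q = -ε * ∫ s in (0 : ℝ)..1, H (q, s) := by
    intro q
    simp only [hG₃, hG₂, hH, hT]
    rw [intervalIntegral.integral_const_mul, ← mul_sub,
      sub_eq_neg_mul_integral_fderiv (isSmooth_slice hφ q.1) q.2 z ε]
    ring
  -- integrability of `H` on `(ℝ × T^d) × [0, 1]`
  have hHsm : StronglyMeasurable H :=
    (((hζc.comp continuous_fst).stronglyMeasurable.mul hiw).comp_measurable measurable_fst).mul
      hTc.stronglyMeasurable
  have hHm : AEStronglyMeasurable H ((volume : Measure (ℝ × UnitAddTorus d)).prod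
      (volume.restrict (Ioc (0 : ℝ) 1))) := hHsm.aestronglyMeasurable
  have hHb : ∀ r : (ℝ × UnitAddTorus d) × ℝ, ‖H r‖ ≤ 1 * (‖e‖ * Mbd) * CD := by
    intro r
    by_cases hr : r.1.1 ∈ Icc a b
    · simp only [hH]
      rw [norm_mul, norm_mul]
      exact mul_le_mul (mul_le_mul (hζq r.1) (hwq _ _) (norm_nonneg _) zero_le_one)
        (hCD _ hr _) (norm_nonneg _) (by positivity)
    · simp only [hH, hζ0 _ hr, zero_mul, norm_zero]
      positivity
  have hHi : Integrable H ((volume : Measure (ℝ × UnitAddTorus d)).prod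
      (volume.restrict (Ioc (0 : ℝ) 1))) := by
    refine IntegrableOn.integrable_of_forall_notMem_eq_zero
      (s := (Icc a b ×ˢ (univ : Set (UnitAddTorus d))) ×ˢ (univ : Set ℝ)) ?_ fun r hr => ?_
    · refine IntegrableOn.of_bound ?_ hHm.restrict (1 * (‖e‖ * Mbd) * CD) (ae_of_all _ hHb)
      rw [Measure.prod_prod, Measure.volume_eq_prod, Measure.prod_prod]
      refine ENNReal.mul_lt_top (ENNReal.mul_lt_top measure_Icc_lt_top (measure_lt_top _ _)) ?_
      rw [Measure.restrict_apply MeasurableSet.univ, univ_inter]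
      exact measure_Ioc_lt_top
    · have h1 : r.1.1 ∉ Icc a b := fun h => hr ⟨⟨h, mem_univ _⟩, mem_univ _⟩
      simp only [hH, hζ0 _ h1, zero_mul]
  -- (iii) the inner identity at fixed `s`: Fubini in `(t, x)` and the representation
  have hinner : ∀ s : ℝ, ∫ q, H (q, s) =
      -∫ q, φ q.1 (q.2 - Torus.proj ((s * ε) • z)) * ⟪e, M q z⟫ ∂μ := by
    intro s
    set ψ : ℝ → UnitAddTorus d → ℝ := fun t x => φ t (x - Torus.proj ((s * ε) • z)) with hψ
    have hψs : ContDiff ℝ ∞ (Torus.stLift ψ) := contDiff_stLift_translate hφ _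
    have hψsupp : ∃ a' b' : ℝ, ∀ t ∉ Icc a' b', ψ t = 0 := by
      obtain ⟨a', b', hab'⟩ := hφsupp
      exact ⟨a', b', fun t ht => funext fun x => by simp [hψ, hab' t ht]⟩
    have hrepψ := hrep ψ hψs hψsupp e z
    have hHψ : ∀ q : ℝ × UnitAddTorus d, H (q, s) = ζ q.1 * (⟪e, w q.1 q.2⟫ * Torus.fderiv (ψ q.1) q.2 z) := by
      intro q
      simp only [hH, hT, hψ]
      rw [torusFderiv_translate]
      ring
    simp_rw [hHψ]
    rw [← hrepψ, neg_neg]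
    -- Fubini `∫ dq = ∫ dt ∫ dx`
    have hfun : (fun q : ℝ × UnitAddTorus d => ζ q.1 * (⟪e, w q.1 q.2⟫ * Torus.fderiv (ψ q.1) q.2 z)) =
        fun q => H (q, s) := funext fun q => (hHψ q).symm
    have hIi : Integrable (fun q : ℝ × UnitAddTorus d =>
        ζ q.1 * (⟪e, w q.1 q.2⟫ * Torus.fderiv (ψ q.1) q.2 z))
        ((volume : Measure ℝ).prod (volume : Measure (UnitAddTorus d))) := by
      rw [hfun, ← Measure.volume_eq_prod]
      refine integrable_of_bound_of_time_support (a := a) (b := b) ?_ (fun q => hHb (q, s))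
        fun q hq => ?_
      · exact (hHsm.comp_measurable (measurable_id.prodMk measurable_const)).aestronglyMeasurable
      · simp only [hH, hζ0 q.1 hq, zero_mul]
    have hprod := integral_prod _ hIi
    rw [← Measure.volume_eq_prod] at hprod
    rw [← hprod]
  -- (iv) assemble
  rw [hsplit, htrans, ← integral_sub hi₃ hi₂]
  simp_rw [hFTC]
  rw [integral_const_mul]
  simp_rw [intervalIntegral.integral_of_le zero_le_one]
  rw [integral_integral_swap hHi]
  simp_rw [hinner]
  rw [integral_neg, integral_Icc_eq_integral_Ioc]
  ring

end Identity

/-! ### Density: smooth test functions realising `∫ |F| Θ` -/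

omit [DecidableEq d] in
/-- Clamping to `[-Θ, Θ]` does not increase the distance to a function with values in
`[-Θ, Θ]`. [folklore] -/
theorem abs_clamp_sub_le {θ g h : ℝ} (hh : |h| ≤ θ) :
    |max (-θ) (min θ g) - h| ≤ |g - h| := by
  have hh' := abs_le.1 hh
  have e1 : h = max (-θ) (min θ h) := by
    rw [min_eq_right hh'.2, max_eq_right hh'.1]
  conv_lhs => rw [e1]
  refine (abs_max_sub_max_le_max _ _ _ _).trans ?_
  rw [sub_self, abs_zero]
  refine max_le (abs_nonneg _) ((abs_min_sub_min_le_max _ _ _ _).trans ?_)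
  rw [sub_self, abs_zero]
  exact max_le (abs_nonneg _) le_rfl

omit [DecidableEq d] in
/-- **Smooth test functions almost realising `∫ |F| Θ`**: for `F ∈ L¹(ℝ × T^d)`, a continuous
compactly supported `Θ ≥ 0` and `η > 0` there is a smooth space–time `φ`, vanishing outside a
compact time interval, with `|φ| ≤ Θ + η` and `∫ |F| Θ ≤ ∫ F φ + η` (density of continuous
functions in `L¹(|F| dx dt)`, clamping to `[-Θ, Θ]`, uniform smoothing). [folklore] -/
theorem exists_smooth_integral_mul_ge {F : ℝ × UnitAddTorus d → ℝ} (hF : Integrable F volume)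
    {Θ : ℝ × UnitAddTorus d → ℝ} (hΘc : Continuous Θ) (hΘs : HasCompactSupport Θ)
    (hΘ0 : ∀ q, 0 ≤ Θ q) {η : ℝ} (hη : 0 < η) :
    ∃ φ : ℝ → UnitAddTorus d → ℝ, ContDiff ℝ ∞ (Torus.stLift φ) ∧
      (∃ a b : ℝ, ∀ t ∉ Icc a b, φ t = 0) ∧ (∀ t x, |φ t x| ≤ Θ (t, x) + η) ∧
      ∫ q, |F q| * Θ q ≤ (∫ q, F q * φ q.1 q.2) + η := by
  -- a strongly measurable representative of `F`
  set F₀ : ℝ × UnitAddTorus d → ℝ := hF.1.mk F with hF₀def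
  have hF₀m : StronglyMeasurable F₀ := hF.1.stronglyMeasurable_mk
  have hFF₀ : F =ᵐ[volume] F₀ := hF.1.ae_eq_mk
  have hF₀ : Integrable F₀ volume := hF.congr hFF₀
  obtain ⟨CΘ, hCΘ⟩ := hΘc.bounded_above_of_compact_support hΘs
  set I : ℝ := ∫ q, ‖F₀ q‖ with hI
  have hI0 : 0 ≤ I := integral_nonneg fun q => norm_nonneg _
  -- the weighted measure `ν = |F₀| dx dt`
  set ν : Measure (ℝ × UnitAddTorus d) := volume.withDensity fun q => ENNReal.ofReal ‖F₀ q‖ with hν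
  haveI : IsFiniteMeasure ν := isFiniteMeasure_withDensity_ofReal hF₀.norm.2
  have hνint : ∀ g : ℝ × UnitAddTorus d → ℝ, ∫ q, g q ∂ν = ∫ q, ‖F₀ q‖ * g q := by
    intro g
    rw [hν, integral_withDensity_eq_integral_toReal_smul hF₀m.measurable.norm.ennreal_ofReal
      (ae_of_all _ fun q => ENNReal.ofReal_lt_top)]
    refine integral_congr_ae (ae_of_all _ fun q => ?_)
    dsimp only
    rw [ENNReal.toReal_ofReal (norm_nonneg _), smul_eq_mul]
  -- the target function `h = sign(F₀) Θ`
  set h : ℝ × UnitAddTorus d → ℝ := fun q => if 0 ≤ F₀ q then Θ q else -Θ q with hh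
  have hhm : StronglyMeasurable h :=
    StronglyMeasurable.ite (measurableSet_le measurable_const hF₀m.measurable)
      hΘc.stronglyMeasurable hΘc.neg.stronglyMeasurable
  have hhΘ : ∀ q, |h q| ≤ Θ q := fun q => by
    by_cases hq : 0 ≤ F₀ q
    · simp only [hh, hq, if_true, abs_of_nonneg (hΘ0 q), le_rfl]
    · simp only [hh, hq, if_false, abs_neg, abs_of_nonneg (hΘ0 q), le_rfl]
  have hFh : ∀ q, F₀ q * h q = ‖F₀ q‖ * Θ q := fun q => by
    by_cases hq : 0 ≤ F₀ q
    · simp only [hh, hq, if_true, Real.norm_eq_abs, abs_of_nonneg hq]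
    · simp only [hh, hq, if_false, Real.norm_eq_abs, abs_of_neg (not_le.1 hq)]
      ring
  have hhi : Integrable h ν :=
    Integrable.of_bound hhm.aestronglyMeasurable CΘ (ae_of_all _ fun q =>
      (by rw [Real.norm_eq_abs]; exact (hhΘ q).trans ((le_abs_self _).trans
        (by rw [← Real.norm_eq_abs]; exact hCΘ q))))
  -- continuous approximation in `L¹(ν)` and clamping
  obtain ⟨g, hg, -⟩ := hhi.exists_boundedContinuous_integral_sub_le (half_pos hη)
  set gc : ℝ × UnitAddTorus d → ℝ := fun q => max (-Θ q) (min (Θ q) (g q)) with hgc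
  have hgcc : Continuous gc := hΘc.neg.max (hΘc.min g.continuous)
  have hgcΘ : ∀ q, |gc q| ≤ Θ q := fun q => by
    rw [abs_le]
    exact ⟨le_max_left _ _, max_le (by linarith [hΘ0 q]) (min_le_left _ _)⟩
  have hgcs : HasCompactSupport gc := by
    refine hΘs.mono fun q hq => ?_
    rw [mem_support] at hq ⊢
    intro h0
    have := hgcΘ q
    rw [h0] at this
    exact hq (abs_nonpos_iff.1 this)
  have hgch : ∀ q, |gc q - h q| ≤ |g q - h q| := fun q => abs_clamp_sub_le (hhΘ q)
  -- uniform smoothing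
  have hδ : 0 < η / (2 * (I + 1)) := by positivity
  obtain ⟨φ, hφs, hφsupp, hφg⟩ := exists_smooth_near hgcc hgcs hδ
  have hδη : η / (2 * (I + 1)) ≤ η := by
    rw [div_le_iff₀ (by positivity)]
    nlinarith
  obtain ⟨hφc, Cφ, hCφ⟩ := continuous_uncurry_and_bounded hφs hφsupp.choose_spec.choose_spec
  refine ⟨φ, hφs, hφsupp, fun t x => ?_, ?_⟩
  · have h1 := hφg t x
    have h2 := hgcΘ (t, x)
    have : |φ t x| ≤ |gc (t, x)| + η / (2 * (I + 1)) := by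
      have := abs_sub_abs_le_abs_sub (φ t x) (gc (t, x))
      linarith
    linarith
  · -- the chain of inequalities, written with the representative `F₀`
    have hA : ∫ q, |F q| * Θ q = ∫ q, F₀ q * h q := by
      refine integral_congr_ae ?_
      filter_upwards [hFF₀] with q hq
      rw [hFh q, hq, Real.norm_eq_abs]
    have hC : ∫ q, F q * φ q.1 q.2 = ∫ q, F₀ q * φ q.1 q.2 := by
      refine integral_congr_ae ?_
      filter_upwards [hFF₀] with q hq
      rw [hq]
    rw [hA, hC]
    -- integrability of the products
    have hiFh : Integrable (fun q => F₀ q * h q) volume :=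
      hF₀.mul_bdd hhm.aestronglyMeasurable (ae_of_all _ fun q =>
        (by rw [Real.norm_eq_abs]; exact (hhΘ q).trans ((le_abs_self _).trans
          (by rw [← Real.norm_eq_abs]; exact hCΘ q))))
    have hiFgc : Integrable (fun q => F₀ q * gc q) volume :=
      hF₀.mul_bdd hgcc.aestronglyMeasurable (ae_of_all _ fun q =>
        (by rw [Real.norm_eq_abs]; exact (hgcΘ q).trans ((le_abs_self _).trans
          (by rw [← Real.norm_eq_abs]; exact hCΘ q))))
    have hiFφ : Integrable (fun q => F₀ q * φ q.1 q.2) volume :=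
      hF₀.mul_bdd hφc.aestronglyMeasurable (ae_of_all _ fun q => hCφ q)
    -- `|∫ F₀ h - ∫ F₀ gc| ≤ η / 2`
    have hAB : |(∫ q, F₀ q * h q) - ∫ q, F₀ q * gc q| ≤ η / 2 := by
      rw [← integral_sub hiFh hiFgc]
      refine abs_integral_le_integral_abs.trans ?_
      have hpt : ∀ q, |F₀ q * h q - F₀ q * gc q| ≤ ‖F₀ q‖ * ‖h q - g q‖ := fun q => by
        rw [← mul_sub, abs_mul, Real.norm_eq_abs, Real.norm_eq_abs, abs_sub_comm (h q) (gc q),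
          abs_sub_comm (h q) (g q)]
        exact mul_le_mul_of_nonneg_left (hgch q) (abs_nonneg _)
      have hbd : ∀ q, ‖‖h q - g q‖‖ ≤ CΘ + ‖g‖ := fun q => by
        rw [norm_norm]
        refine (norm_sub_le _ _).trans (add_le_add ?_ (g.norm_coe_le_norm q))
        rw [Real.norm_eq_abs]
        exact (hhΘ q).trans ((le_abs_self _).trans (by rw [← Real.norm_eq_abs]; exact hCΘ q))
      have hint2 : Integrable (fun q => ‖F₀ q‖ * ‖h q - g q‖) volume :=
        hF₀.norm.mul_bdd (hhm.sub g.continuous.stronglyMeasurable).norm.aestronglyMeasurable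
          (ae_of_all _ hbd)
      calc ∫ q, |F₀ q * h q - F₀ q * gc q| ≤ ∫ q, ‖F₀ q‖ * ‖h q - g q‖ :=
            integral_mono_of_nonneg (ae_of_all _ fun q => abs_nonneg _) hint2 (ae_of_all _ hpt)
        _ = ∫ q, ‖h q - g q‖ ∂ν := (hνint _).symm
        _ ≤ η / 2 := hg
    -- `|∫ F₀ gc - ∫ F₀ φ| ≤ η / 2`
    have hBC : |(∫ q, F₀ q * gc q) - ∫ q, F₀ q * φ q.1 q.2| ≤ η / 2 := by
      rw [← integral_sub hiFgc hiFφ]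
      refine abs_integral_le_integral_abs.trans ?_
      calc ∫ q, |F₀ q * gc q - F₀ q * φ q.1 q.2| ≤ ∫ q, ‖F₀ q‖ * (η / (2 * (I + 1))) := by
            refine integral_mono_of_nonneg (ae_of_all _ fun q => abs_nonneg _)
              (hF₀.norm.mul_const _) (ae_of_all _ fun q => ?_)
            dsimp only
            rw [← mul_sub, abs_mul, Real.norm_eq_abs, abs_sub_comm]
            exact mul_le_mul_of_nonneg_left (hφg q.1 q.2) (abs_nonneg _)
        _ = I * (η / (2 * (I + 1))) := by rw [integral_mul_const]
        _ ≤ η / 2 := by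
            have hI1 : (0 : ℝ) < I + 1 := by positivity
            have h1 : I / (I + 1) ≤ 1 := (div_le_one hI1).2 (by linarith)
            calc I * (η / (2 * (I + 1))) = (η / 2) * (I / (I + 1)) := by
                  field_simp
              _ ≤ (η / 2) * 1 := mul_le_mul_of_nonneg_left h1 (by positivity)
              _ = η / 2 := mul_one _
    linarith [(abs_le.1 hAB).2, (abs_le.1 hBC).2]


/-! ### The increment estimate -/

section Estimate

variable {μ : Measure (ℝ × UnitAddTorus d)}
  {M : ℝ × UnitAddTorus d → EuclideanSpace ℝ d →L[ℝ] EuclideanSpace ℝ d}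

omit [DecidableEq d] in
/-- `q ↦ ⟪e, M q z⟫` is strongly measurable and bounded by `‖e‖ K ‖z‖`. [folklore] -/
theorem stronglyMeasurable_inner_apply (hM : StronglyMeasurable M) {K : ℝ} (hMK : ∀ q, ‖M q‖ ≤ K)
    (e z : EuclideanSpace ℝ d) :
    StronglyMeasurable (fun q => ⟪e, M q z⟫) ∧ ∀ q, |⟪e, M q z⟫| ≤ ‖e‖ * K * ‖z‖ := by
  refine ⟨(continuous_const.inner continuous_id).comp_stronglyMeasurable
    ((ContinuousLinearMap.apply ℝ (EuclideanSpace ℝ d) z).continuous.comp_stronglyMeasurable hM),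
    fun q => ?_⟩
  rw [← Real.norm_eq_abs]
  refine (norm_inner_le_norm _ _).trans ?_
  rw [mul_assoc]
  exact mul_le_mul_of_nonneg_left ((M q).le_of_opNorm_le (hMK q) z) (norm_nonneg _)

omit [DecidableEq d] in
/-- Continuity in the shift parameter of `s ↦ ∫ g(t, x - sεz) m(t,x) dμ` for continuous bounded `g`
and integrable `m` (dominated convergence). [folklore] -/
theorem continuous_integral_shift_mul [IsFiniteMeasure μ] {g : ℝ × UnitAddTorus d → ℝ}
    (hg : Continuous g) {C : ℝ} (hgC : ∀ q, |g q| ≤ C) {m : ℝ × UnitAddTorus d → ℝ}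
    (hm : Integrable m μ) (z : EuclideanSpace ℝ d) (ε : ℝ) :
    Continuous fun s : ℝ => ∫ q, g (q.1, q.2 - Torus.proj ((s * ε) • z)) * m q ∂μ := by
  have hC : 0 ≤ C := (abs_nonneg _).trans (hgC (0, 0))
  refine continuous_of_dominated (bound := fun q => C * ‖m q‖) (fun s => ?_) (fun s => ?_)
    (hm.norm.const_mul C) (ae_of_all _ fun q => ?_)
  · refine ((hg.comp ?_).aestronglyMeasurable).mul hm.1
    exact continuous_fst.prodMk (continuous_snd.sub continuous_const)
  · refine ae_of_all _ fun q => ?_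
    rw [norm_mul, Real.norm_eq_abs]
    exact mul_le_mul_of_nonneg_right (hgC _) (norm_nonneg _)
  · refine ((hg.comp ?_).mul continuous_const)
    exact continuous_const.prodMk (continuous_const.sub (Torus.continuous_proj.comp
      ((continuous_id.mul continuous_const).smul continuous_const)))

omit [DecidableEq d] in
/-- **The `BV` increment estimate by duality** (De Rosa–Inversi 2024, Lemma 2.2 on the torus, with
`ε|z·∇f|((A)_ε)` in its dualised space–time form): for a continuous compactly supported weight
`Θ ≥ 0`, all `e, z` and `ε > 0`,
`∫ |ζ(t) ⟪e, w(t, x + εz) - w(t, x)⟫| Θ dx dt ≤ ε ∫₀¹ ∫ Θ(t, x - sεz) |⟪e, M(t,x) z⟫| dμ ds`. [cite: DeRosaInversi2024, Lemma 2.2] -/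
theorem integral_abs_inner_increment_mul_le {w : ℝ → UnitAddTorus d → EuclideanSpace ℝ d}
    {Mbd : ℝ} (hw : StronglyMeasurable (uncurry w)) (hwb : ∀ t x, ‖w t x‖ ≤ Mbd)
    {ζ : ℝ → ℝ} {a b : ℝ} (hζc : Continuous ζ) (hζ1 : ∀ t, |ζ t| ≤ 1)
    (hζ0 : ∀ t ∉ Icc a b, ζ t = 0) [IsFiniteMeasure μ] (hM : StronglyMeasurable M) {K : ℝ}
    (hMK : ∀ q, ‖M q‖ ≤ K)
    (hrep : ∀ φ : ℝ → UnitAddTorus d → ℝ, ContDiff ℝ ∞ (Torus.stLift φ) →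
      (∃ a' b' : ℝ, ∀ t ∉ Icc a' b', φ t = 0) → ∀ e z : EuclideanSpace ℝ d,
        -∫ t, ∫ x, ζ t * (⟪e, w t x⟫ * Torus.fderiv (φ t) x z) =
          ∫ q, φ q.1 q.2 * ⟪e, M q z⟫ ∂μ)
    {Θ : ℝ × UnitAddTorus d → ℝ} (hΘc : Continuous Θ) (hΘs : HasCompactSupport Θ)
    (hΘ0 : ∀ q, 0 ≤ Θ q) (e z : EuclideanSpace ℝ d) {ε : ℝ} (hε : 0 < ε) :
    ∫ q : ℝ × UnitAddTorus d, |ζ q.1 * ⟪e, w q.1 (q.2 + Torus.proj (ε • z)) - w q.1 q.2⟫| * Θ q ≤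
      ε * ∫ s in Icc (0 : ℝ) 1, ∫ q, Θ (q.1, q.2 - Torus.proj ((s * ε) • z)) * |⟪e, M q z⟫| ∂μ := by
  have hMbd : 0 ≤ Mbd := (norm_nonneg _).trans (hwb 0 0)
  have hK : 0 ≤ K := (norm_nonneg _).trans (hMK (0, 0))
  obtain ⟨hmm, hmb⟩ := stronglyMeasurable_inner_apply hM hMK e z
  obtain ⟨CΘ, hCΘ⟩ := hΘc.bounded_above_of_compact_support hΘs
  set m : ℝ × UnitAddTorus d → ℝ := fun q => ⟪e, M q z⟫ with hmdef
  have hmi : Integrable m μ := Integrable.of_bound hmm.aestronglyMeasurable _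
    (ae_of_all _ fun q => by rw [Real.norm_eq_abs]; exact hmb q)
  have hmai : Integrable (fun q => |m q|) μ := hmi.abs
  -- the function `F = ζ ⟪e, δ_{εz} w⟫`
  set F : ℝ × UnitAddTorus d → ℝ := fun q =>
    ζ q.1 * ⟪e, w q.1 (q.2 + Torus.proj (ε • z)) - w q.1 q.2⟫ with hFdef
  have hFm : AEStronglyMeasurable F volume := by
    have h1 : StronglyMeasurable fun q : ℝ × UnitAddTorus d =>
        ⟪e, w q.1 (q.2 + Torus.proj (ε • z)) - w q.1 q.2⟫ :=
      (continuous_const.inner continuous_id).comp_stronglyMeasurable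
        ((hw.comp_measurable (measurable_fst.prodMk (measurable_snd.add_const _))).sub hw)
    exact ((hζc.comp continuous_fst).stronglyMeasurable.mul h1).aestronglyMeasurable
  have hFi : Integrable F volume := by
    refine integrable_of_bound_of_time_support (a := a) (b := b) hFm (C := 1 * (‖e‖ * (Mbd + Mbd)))
      (fun q => ?_) fun q hq => by simp only [hFdef, hζ0 q.1 hq, zero_mul]
    rw [hFdef, norm_mul]
    refine mul_le_mul (by rw [Real.norm_eq_abs]; exact hζ1 q.1) ?_ (norm_nonneg _) zero_le_one
    refine (norm_inner_le_norm _ _).trans (mul_le_mul_of_nonneg_left ?_ (norm_nonneg _))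
    exact (norm_sub_le _ _).trans (add_le_add (hwb _ _) (hwb _ _))
  -- the constant `C₀ = ∫ |m| dμ`
  set C₀ : ℝ := ∫ q, |m q| ∂μ with hC₀
  have hC₀0 : 0 ≤ C₀ := integral_nonneg fun q => abs_nonneg _
  set R : ℝ := ∫ s in Icc (0 : ℝ) 1, ∫ q, Θ (q.1, q.2 - Torus.proj ((s * ε) • z)) * |m q| ∂μ with hR
  -- `∀ η > 0`, `∫ |F| Θ ≤ ε R + η`
  refine le_of_forall_pos_le_add fun η₀ hη₀ => ?_
  have hden : 0 < ε * C₀ + 1 := by positivity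
  set η : ℝ := η₀ / (ε * C₀ + 1) with hηdef
  have hη : 0 < η := by positivity
  obtain ⟨φ, hφs, hφsupp, hφΘ, hφF⟩ := exists_smooth_integral_mul_ge hFi hΘc hΘs hΘ0 hη
  obtain ⟨hφc, Cφ, hCφ⟩ := continuous_uncurry_and_bounded hφs hφsupp.choose_spec.choose_spec
  -- the identity for `φ`
  have hid := integral_mul_inner_increment_mul_eq hw hwb hζc hζ1 hζ0 hrep hφs hφsupp e z ε
  have hid' : ∫ q, F q * φ q.1 q.2 =
      ε * ∫ s in Icc (0 : ℝ) 1, ∫ q, φ q.1 (q.2 - Torus.proj ((s * ε) • z)) * m q ∂μ := by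
    rw [← hid]
  -- pointwise in `s`: `∫ φ(· - sεz) m dμ ≤ ∫ (Θ(· - sεz) + η) |m| dμ`
  have hAs : Continuous fun s : ℝ => ∫ q, φ q.1 (q.2 - Torus.proj ((s * ε) • z)) * m q ∂μ := by
    have h := continuous_integral_shift_mul (g := uncurry φ) hφc
      (fun q => by rw [← Real.norm_eq_abs]; exact hCφ q) hmi z ε
    exact h
  have hBs : Continuous fun s : ℝ =>
      ∫ q, (Θ (q.1, q.2 - Torus.proj ((s * ε) • z)) + η) * |m q| ∂μ := by
    have hΘη : Continuous fun q : ℝ × UnitAddTorus d => Θ q + η := hΘc.add continuous_const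
    exact continuous_integral_shift_mul (g := fun q => Θ q + η) hΘη
      (C := CΘ + η) (fun q => by
        rw [abs_of_nonneg (by linarith [hΘ0 q])]
        exact add_le_add ((le_abs_self _).trans (by rw [← Real.norm_eq_abs]; exact hCΘ q)) le_rfl)
      hmai z ε
  have hRs : Continuous fun s : ℝ =>
      ∫ q, Θ (q.1, q.2 - Torus.proj ((s * ε) • z)) * |m q| ∂μ :=
    continuous_integral_shift_mul hΘc (C := CΘ)
      (fun q => by rw [← Real.norm_eq_abs]; exact hCΘ q) hmai z ε
  have hle : ∀ s, ∫ q, φ q.1 (q.2 - Torus.proj ((s * ε) • z)) * m q ∂μ ≤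
      ∫ q, (Θ (q.1, q.2 - Torus.proj ((s * ε) • z)) + η) * |m q| ∂μ := by
    intro s
    refine integral_mono ?_ ?_ fun q => ?_
    · exact hmi.bdd_mul ((hφc.comp (continuous_fst.prodMk (continuous_snd.sub
        continuous_const))).aestronglyMeasurable)
        (ae_of_all _ fun q => hCφ (q.1, q.2 - Torus.proj ((s * ε) • z)))
    · exact hmai.bdd_mul (((hΘc.comp (continuous_fst.prodMk (continuous_snd.sub
        continuous_const))).add continuous_const).aestronglyMeasurable)
        (ae_of_all _ fun q => by
          rw [Real.norm_eq_abs, abs_of_nonneg (by linarith [hΘ0 (q.1, q.2 - Torus.proj ((s * ε) • z))])]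
          exact add_le_add ((le_abs_self _).trans (by rw [← Real.norm_eq_abs]; exact hCΘ _)) le_rfl)
    · calc φ q.1 (q.2 - Torus.proj ((s * ε) • z)) * m q
          ≤ |φ q.1 (q.2 - Torus.proj ((s * ε) • z)) * m q| := le_abs_self _
        _ = |φ q.1 (q.2 - Torus.proj ((s * ε) • z))| * |m q| := abs_mul _ _
        _ ≤ (Θ (q.1, q.2 - Torus.proj ((s * ε) • z)) + η) * |m q| :=
            mul_le_mul_of_nonneg_right (hφΘ _ _) (abs_nonneg _)
  have hint_le : ∫ s in Icc (0 : ℝ) 1, ∫ q, φ q.1 (q.2 - Torus.proj ((s * ε) • z)) * m q ∂μ ≤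
      ∫ s in Icc (0 : ℝ) 1, ∫ q, (Θ (q.1, q.2 - Torus.proj ((s * ε) • z)) + η) * |m q| ∂μ :=
    setIntegral_mono (hAs.integrableOn_Icc) (hBs.integrableOn_Icc) hle
  -- split the right-hand side
  have hsplit : ∫ s in Icc (0 : ℝ) 1, ∫ q, (Θ (q.1, q.2 - Torus.proj ((s * ε) • z)) + η) * |m q| ∂μ =
      R + η * C₀ := by
    have h1 : ∀ s, ∫ q, (Θ (q.1, q.2 - Torus.proj ((s * ε) • z)) + η) * |m q| ∂μ =
        (∫ q, Θ (q.1, q.2 - Torus.proj ((s * ε) • z)) * |m q| ∂μ) + η * C₀ := by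
      intro s
      rw [hC₀, ← integral_const_mul, ← integral_add]
      · refine integral_congr_ae (ae_of_all _ fun q => ?_)
        ring
      · exact hmai.bdd_mul ((hΘc.comp (continuous_fst.prodMk (continuous_snd.sub
          continuous_const))).aestronglyMeasurable) (ae_of_all _ fun q => hCΘ _)
      · exact hmai.const_mul η
    simp_rw [h1]
    rw [integral_add hRs.integrableOn_Icc (integrableOn_const (by simp)), setIntegral_const,
      Real.volume_real_Icc_of_le zero_le_one]
    simp [hR]
  -- conclude
  have hkey : ∫ q, |F q| * Θ q ≤ ε * R + η * (ε * C₀ + 1) := by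
    calc ∫ q, |F q| * Θ q ≤ (∫ q, F q * φ q.1 q.2) + η := hφF
      _ = ε * (∫ s in Icc (0 : ℝ) 1, ∫ q, φ q.1 (q.2 - Torus.proj ((s * ε) • z)) * m q ∂μ) + η := by
          rw [hid']
      _ ≤ ε * (R + η * C₀) + η := by
          rw [← hsplit]
          exact add_le_add (mul_le_mul_of_nonneg_left hint_le hε.le) le_rfl
      _ = ε * R + η * (ε * C₀ + 1) := by ring
  have hηfin : η * (ε * C₀ + 1) = η₀ := by
    rw [hηdef, div_mul_cancel₀ _ hden.ne']
  rw [hηfin] at hkey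
  exact hkey

end Estimate

end Duality

section FluxBound

open MeasureTheory TopologicalSpace Set Function Filter Topology
open scoped ENNReal NNReal RealInnerProductSpace ContDiff

open Literature.Analysis Literature.Analysis.FunctionSpaces Literature.Analysis.FluidPDE

variable {d : Type} [Fintype d] [DecidableEq d]

/-! ### The flux does not see null sets -/

omit [DecidableEq d] in
/-- The Duchon–Robert flux `D_ε(v)` depends only on the a.e.-class of the slice `v`. [folklore] -/
theorem duchonRobertApprox_congr_ae {v v' : UnitAddTorus d → EuclideanSpace ℝ d}
    (h : v =ᵐ[volume] v') (φ : EuclideanSpace ℝ d → ℝ) (ε : ℝ) :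
    (fun x => Torus.duchonRobertApprox φ ε v x) =ᵐ[volume]
      fun x => Torus.duchonRobertApprox φ ε v' x := by
  have hprod : ∀ᵐ p : UnitAddTorus d × EuclideanSpace ℝ d ∂((volume : Measure (UnitAddTorus d)).prod
      volume), v (p.1 + Torus.proj p.2) = v' (p.1 + Torus.proj p.2) :=
    Torus.quasiMeasurePreserving_add_proj.ae_eq h
  filter_upwards [h, Measure.ae_ae_of_ae_prod hprod] with x hx hx'
  simp only [Torus.duchonRobertApprox]
  congr 1
  refine integral_congr_ae ?_
  filter_upwards [hx'] with ξ hξ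
  simp only [Torus.increment, hx, hξ]

omit [DecidableEq d] in
/-- The defect pairings of `u` and of a representative `w` agree, for test functions supported in
time inside the slab where `w = u` a.e. [folklore] -/
theorem integral_duchonRobert_congr {T : ℝ} {u w : ℝ → UnitAddTorus d → EuclideanSpace ℝ d}
    {a b a' b' : ℝ} (hsub : Icc a' b' ⊆ Icc a b)
    (huw : ∀ᵐ t ∂(volume.restrict (Icc a b)), w t =ᵐ[volume] u t)
    {θ : ℝ → UnitAddTorus d → ℝ} (hθsupp : ∀ t ∉ Icc a' b', θ t = 0)
    (φ : EuclideanSpace ℝ d → ℝ) (ε : ℝ) :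
    ∫ t in Ioo 0 T, ∫ x, Torus.duchonRobertApprox φ ε (u t) x * θ t x =
      ∫ t in Ioo 0 T, ∫ x, Torus.duchonRobertApprox φ ε (w t) x * θ t x := by
  have huw' : ∀ᵐ t ∂(volume : Measure ℝ), t ∈ Icc a b → w t =ᵐ[volume] u t :=
    (ae_restrict_iff' measurableSet_Icc).1 huw
  refine integral_congr_ae (ae_restrict_of_ae ?_)
  filter_upwards [huw'] with t ht
  by_cases hθt : θ t = 0
  · simp [hθt]
  · have htI : t ∈ Icc a' b' := by
      by_contra h'
      exact hθt (hθsupp t h')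
    refine integral_congr_ae ?_
    filter_upwards [duchonRobertApprox_congr_ae (ht (hsub htI)) φ ε] with x hx
    rw [hx]

/-! ### The rescaled gradient and the pointwise structure bound -/

omit [DecidableEq d] in
/-- `⟪∇(φ^ε)(ξ), v⟫ = ε^{-d} ε⁻¹ Dφ(ξ/ε) v` for a differentiable `φ`. [folklore] -/
theorem inner_gradient_mollifierScale {φ : EuclideanSpace ℝ d → ℝ} (hφ : Differentiable ℝ φ)
    (ε : ℝ) (ξ v : EuclideanSpace ℝ d) :
    ⟪gradient (FluidPDE.mollifierScale ε φ) ξ, v⟫ =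
      (ε ^ Fintype.card d)⁻¹ * (ε⁻¹ * fderiv ℝ φ (ε⁻¹ • ξ) v) := by
  rw [gradient, InnerProductSpace.toDual_symm_apply,
    (Torus.hasFDerivAt_mollifierScale hφ ε ξ).fderiv]
  simp [smul_eq_mul]

omit [DecidableEq d] in
/-- `⟪∇φ(z), v⟫ = Dφ(z) v`. [folklore] -/
theorem inner_gradient_eq_fderiv (φ : EuclideanSpace ℝ d → ℝ) (z v : EuclideanSpace ℝ d) :
    ⟪gradient φ z, v⟫ = fderiv ℝ φ z v := by
  rw [gradient, InnerProductSpace.toDual_symm_apply]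

omit [DecidableEq d] in
/-- At the rescaled point: `⟪∇(φ^ε)(εz), M (εz)⟫ = ε^{-d} Dφ(z)(Mz)` (`ε ≠ 0`). [folklore] -/
theorem inner_gradient_mollifierScale_smul {φ : EuclideanSpace ℝ d → ℝ} (hφ : Differentiable ℝ φ)
    {ε : ℝ} (hε : ε ≠ 0) (z : EuclideanSpace ℝ d)
    (A : EuclideanSpace ℝ d →L[ℝ] EuclideanSpace ℝ d) :
    ⟪gradient (FluidPDE.mollifierScale ε φ) (ε • z), A (ε • z)⟫ =
      (ε ^ Fintype.card d)⁻¹ * fderiv ℝ φ z (A z) := by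
  rw [inner_gradient_mollifierScale hφ, smul_smul, inv_mul_cancel₀ hε, one_smul, map_smul, map_smul,
    smul_eq_mul, ← mul_assoc ε⁻¹, inv_mul_cancel₀ hε, one_mul]

omit [DecidableEq d] in
/-- **Pointwise structure bound of the flux of a bounded field**: if `‖v‖ ≤ Mbd` everywhere then
`‖D_ε(v)(x)‖ₑ ≤ Mbd² ∫⁻ ‖⟪∇φ^ε(ξ), δv(x;ξ)⟫‖ₑ dξ` (keep the inner product, bound `|δv|² ≤ 4 Mbd²`;
De Rosa–Inversi 2024, §4, first display). [cite: DeRosaInversi2024, §4] -/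
theorem enorm_duchonRobertApprox_le_structure (φ : EuclideanSpace ℝ d → ℝ) (ε : ℝ)
    {v : UnitAddTorus d → EuclideanSpace ℝ d} {Mbd : ℝ} (hv : ∀ x, ‖v x‖ ≤ Mbd) (x : UnitAddTorus d) :
    ‖Torus.duchonRobertApprox φ ε v x‖ₑ ≤
      ENNReal.ofReal (Mbd ^ 2) *
        ∫⁻ ξ, ‖⟪gradient (FluidPDE.mollifierScale ε φ) ξ, Torus.increment v ξ x⟫‖ₑ := by
  have hMbd : 0 ≤ Mbd := (norm_nonneg _).trans (hv x)
  have hδ : ∀ ξ, ‖Torus.increment v ξ x‖ ≤ 2 * Mbd := fun ξ => by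
    rw [Torus.increment, two_mul]
    exact (norm_sub_le _ _).trans (add_le_add (hv _) (hv _))
  rw [Torus.duchonRobertApprox, enorm_mul, Real.enorm_eq_ofReal (by norm_num : (0 : ℝ) ≤ 4⁻¹)]
  calc ENNReal.ofReal 4⁻¹ * ‖∫ ξ, ⟪gradient (FluidPDE.mollifierScale ε φ) ξ, Torus.increment v ξ x⟫ *
        ‖Torus.increment v ξ x‖ ^ 2‖ₑ
      ≤ ENNReal.ofReal 4⁻¹ * ∫⁻ ξ, ‖⟪gradient (FluidPDE.mollifierScale ε φ) ξ,
          Torus.increment v ξ x⟫‖ₑ * ENNReal.ofReal ((2 * Mbd) ^ 2) := by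
        gcongr
        refine (enorm_integral_le_lintegral_enorm _).trans (lintegral_mono fun ξ => ?_)
        rw [enorm_mul, Real.enorm_eq_ofReal (sq_nonneg _)]
        gcongr
        exact hδ ξ
    _ = ENNReal.ofReal (Mbd ^ 2) *
          ∫⁻ ξ, ‖⟪gradient (FluidPDE.mollifierScale ε φ) ξ, Torus.increment v ξ x⟫‖ₑ := by
        rw [lintegral_mul_const' _ _ ENNReal.ofReal_ne_top]
        rw [show ENNReal.ofReal 4⁻¹ * ((∫⁻ ξ, ‖⟪gradient (FluidPDE.mollifierScale ε φ) ξ,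
            Torus.increment v ξ x⟫‖ₑ) * ENNReal.ofReal ((2 * Mbd) ^ 2)) =
            (ENNReal.ofReal 4⁻¹ * ENNReal.ofReal ((2 * Mbd) ^ 2)) *
              ∫⁻ ξ, ‖⟪gradient (FluidPDE.mollifierScale ε φ) ξ, Torus.increment v ξ x⟫‖ₑ by ring]
        rw [← ENNReal.ofReal_mul (by positivity)]
        congr 2
        ring

/-! ### Change of variables in `ℝ^d` -/

omit [DecidableEq d] in
/-- Dilations of Lebesgue measure, lower-integral form: `∫⁻ g(ξ) dξ = ε^d ∫⁻ g(εz) dz` (`ε > 0`). [folklore] -/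
theorem lintegral_eq_mul_lintegral_comp_smul (g : EuclideanSpace ℝ d → ℝ≥0∞) {ε : ℝ} (hε : 0 < ε) :
    ∫⁻ ξ, g ξ = ENNReal.ofReal (ε ^ Fintype.card d) * ∫⁻ z, g (ε • z) := by
  have h : ∫⁻ z, g (ε • z) = ENNReal.ofReal |(ε ^ Fintype.card d)⁻¹| * ∫⁻ ξ, g ξ := by
    calc ∫⁻ z, g (ε • z) = ∫⁻ ξ, g ξ ∂(Measure.map (fun x : EuclideanSpace ℝ d => ε • x) volume) :=
          (lintegral_map_equiv g
            (Homeomorph.smul (isUnit_iff_ne_zero.2 hε.ne').unit).toMeasurableEquiv).symm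
      _ = ENNReal.ofReal |(ε ^ Fintype.card d)⁻¹| * ∫⁻ ξ, g ξ := by
          rw [Measure.map_addHaar_smul volume hε.ne', lintegral_smul_measure, smul_eq_mul,
            finrank_euclideanSpace]
  rw [h, ← mul_assoc, abs_of_pos (inv_pos.2 (pow_pos hε _)), ← ENNReal.ofReal_mul (pow_pos hε _).le,
    mul_inv_cancel₀ (pow_pos hε _).ne', ENNReal.ofReal_one, one_mul]

/-! ### Measurability of evaluations -/

omit [DecidableEq d] in
/-- Evaluation of a measurable operator field at a measurable vector field is measurable. [folklore] -/
theorem measurable_clm_apply₂ {α : Type*} [MeasurableSpace α]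
    {A : α → EuclideanSpace ℝ d →L[ℝ] EuclideanSpace ℝ d} (hA : Measurable A)
    {v : α → EuclideanSpace ℝ d} (hv : Measurable v) : Measurable fun a => A a (v a) := by
  have hc : Continuous fun p : (EuclideanSpace ℝ d →L[ℝ] EuclideanSpace ℝ d) × EuclideanSpace ℝ d =>
      p.1 p.2 := isBoundedBilinearMap_apply.continuous
  exact hc.measurable.comp (hA.prodMk hv)

omit [DecidableEq d] in
/-- Evaluation of a continuous family of linear forms at a measurable vector field is measurable. [folklore] -/
theorem measurable_dual_apply₂ {α : Type*} [MeasurableSpace α]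
    {ℓ : α → EuclideanSpace ℝ d →L[ℝ] ℝ} (hℓ : Measurable ℓ)
    {v : α → EuclideanSpace ℝ d} (hv : Measurable v) : Measurable fun a => ℓ a (v a) := by
  have hc : Continuous fun p : (EuclideanSpace ℝ d →L[ℝ] ℝ) × EuclideanSpace ℝ d => p.1 p.2 :=
    isBoundedBilinearMap_apply.continuous
  exact hc.measurable.comp (hℓ.prodMk hv)

/-! ### The structure bound -/

omit [DecidableEq d] in
/-- **Ambrosio's structure bound for the Duchon–Robert defect** (De Rosa–Inversi 2024, (1.9) and
§4: `|⟨D[u], ψ⟩| ≲ ‖u‖²_{L^∞} ∫_{B₁} (∫_S |∇ρ(z) · M_{x,t} z| dν) dz`). In the tree's vocabulary: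
let `D` be a Duchon–Robert defect of `u` on `(0, T)`, `w` a strongly measurable representative of
`u` on `[a, b] × T^d` with `‖w‖ ≤ Mbd`, `ζ` a continuous cut-off supported in `[a, b]`, `= 1` on
`[a', b'] ⊆ [a, b]`, `|ζ| ≤ 1`, and `(μ, M)` a finite measure and a bounded strongly measurable
matrix field representing `-∫∫ ζ ⟪e, w⟫ Dφ z = ∫ φ ⟪e, M z⟫ dμ`. Then for every test function `θ`
supported in time in `[a', b']`, every continuous compactly supported `Θ ≥ |θ|` and every
mollifier `ρ`, `|D θ| ≤ Mbd² ∫ (∫ |Dρ(z)(M z)| dz) Θ dμ`. [cite: DeRosaInversi2024, §4 and (1.9)] -/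
theorem abs_defect_le {T : ℝ} {u w : ℝ → UnitAddTorus d → EuclideanSpace ℝ d}
    {D : Torus.STFunctional d} (hD : Torus.HasDuchonRobertDefect T u D)
    {Mbd : ℝ} (hw : StronglyMeasurable (uncurry w)) (hwb : ∀ t x, ‖w t x‖ ≤ Mbd)
    {a b a' b' : ℝ} (hsub : Icc a' b' ⊆ Icc a b)
    (huw : ∀ᵐ t ∂(volume.restrict (Icc a b)), w t =ᵐ[volume] u t)
    {ζ : ℝ → ℝ} (hζc : Continuous ζ) (hζ1 : ∀ t, |ζ t| ≤ 1) (hζ0 : ∀ t ∉ Icc a b, ζ t = 0)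
    (hζone : ∀ t ∈ Icc a' b', ζ t = 1)
    {μ : Measure (ℝ × UnitAddTorus d)} [IsFiniteMeasure μ]
    {M : ℝ × UnitAddTorus d → EuclideanSpace ℝ d →L[ℝ] EuclideanSpace ℝ d}
    (hM : StronglyMeasurable M) {K : ℝ} (hMK : ∀ q, ‖M q‖ ≤ K)
    (hrep : ∀ φ : ℝ → UnitAddTorus d → ℝ, ContDiff ℝ ∞ (Torus.stLift φ) →
      (∃ a'' b'' : ℝ, ∀ t ∉ Icc a'' b'', φ t = 0) → ∀ e z : EuclideanSpace ℝ d,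
        -∫ t, ∫ x, ζ t * (⟪e, w t x⟫ * Torus.fderiv (φ t) x z) =
          ∫ q, φ q.1 q.2 * ⟪e, M q z⟫ ∂μ)
    {θ : ℝ → UnitAddTorus d → ℝ} (hθ : Torus.IsSpaceTimeTestIoo T θ)
    (hθsupp : ∀ t ∉ Icc a' b', θ t = 0)
    {Θ : ℝ × UnitAddTorus d → ℝ} (hΘc : Continuous Θ) (hΘs : HasCompactSupport Θ)
    (hΘ0 : ∀ q, 0 ≤ Θ q) (hθΘ : ∀ t x, |θ t x| ≤ Θ (t, x))
    {ρ : EuclideanSpace ℝ d → ℝ} (hρ : FluidPDE.IsMollifier ρ) :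
    |D θ| ≤ Mbd ^ 2 * ∫ q, (∫ z, |fderiv ℝ ρ z (M q z)|) * Θ q ∂μ := by
  have hMbd : 0 ≤ Mbd := (norm_nonneg _).trans (hwb 0 0)
  have hK : 0 ≤ K := (norm_nonneg _).trans (hMK (0, 0))
  have hρd : Differentiable ℝ ρ := hρ.1.differentiable (by simp)
  have hρ1 : ContDiff ℝ 1 ρ := hρ.1.of_le (by simp)
  obtain ⟨CΘ, hCΘ⟩ := hΘc.bounded_above_of_compact_support hΘs
  have hCΘ0 : 0 ≤ CΘ := (norm_nonneg _).trans (hCΘ (0, 0))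
  have hθc : Continuous (uncurry θ) := Torus.continuous_uncurry_of_continuous_stLift hθ.1.1.continuous
  -- the defect pairings of `u` tend to `D θ`, and equal those of `w`
  have hlim : Tendsto (fun ε => ∫ t in Ioo 0 T, ∫ x, Torus.duchonRobertApprox ρ ε (w t) x * θ t x)
      (𝓝[>] 0) (𝓝 (D θ)) := by
    refine (hD ρ hρ θ hθ).congr fun ε => ?_
    exact integral_duchonRobert_congr hsub huw hθsupp ρ ε
  /- the product measures: `π = ds|[0,1] ⊗ μ` on `ℝ × (ℝ × T^d)` and `PP = dz ⊗ π` -/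
  set π : Measure (ℝ × (ℝ × UnitAddTorus d)) := (volume.restrict (Icc (0 : ℝ) 1)).prod μ with hπ
  haveI : IsFiniteMeasure π := by
    rw [hπ]
    infer_instance
  set PP : Measure (EuclideanSpace ℝ d × (ℝ × (ℝ × UnitAddTorus d))) := (volume : Measure
    (EuclideanSpace ℝ d)).prod π with hPP
  -- the integrands `Φ ε`
  set Φ : ℝ → EuclideanSpace ℝ d × (ℝ × (ℝ × UnitAddTorus d)) → ℝ := fun ε p =>
    Θ (p.2.2.1, p.2.2.2 - Torus.proj ((p.2.1 * ε) • p.1)) * |fderiv ℝ ρ p.1 (M p.2.2 p.1)| with hΦ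
  have hΦm : ∀ ε, Measurable (Φ ε) := by
    intro ε
    refine Measurable.mul ?_ ?_
    · refine hΘc.measurable.comp ?_
      exact (measurable_fst.comp (measurable_snd.comp measurable_snd)).prodMk
        ((measurable_snd.comp (measurable_snd.comp measurable_snd)).sub
          (Torus.measurable_proj.comp (((measurable_fst.comp measurable_snd).mul
            measurable_const).smul measurable_fst)))
    · refine (measurable_dual_apply₂ ((hρ1.continuous_fderiv one_ne_zero).measurable.comp
        measurable_fst) ?_).abs
      exact measurable_clm_apply₂ (hM.measurable.comp (measurable_snd.comp measurable_snd))
        measurable_fst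
  -- the dominating function
  set B : EuclideanSpace ℝ d × (ℝ × (ℝ × UnitAddTorus d)) → ℝ := fun p =>
    (CΘ * K * (‖fderiv ℝ ρ p.1‖ * ‖p.1‖)) * 1 with hB
  have hBi : Integrable B PP := by
    rw [hPP]
    exact ((integrable_norm_fderiv_mul_norm hρ1 hρ.2.1).const_mul (CΘ * K)).mul_prod
      (integrable_const (1 : ℝ))
  have hΦB : ∀ ε p, ‖Φ ε p‖ ≤ B p := by
    intro ε p
    simp only [hΦ, hB, mul_one]
    rw [norm_mul, Real.norm_eq_abs, Real.norm_eq_abs, abs_abs]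
    have h1 : |Θ (p.2.2.1, p.2.2.2 - Torus.proj ((p.2.1 * ε) • p.1))| ≤ CΘ := by
      rw [← Real.norm_eq_abs]; exact hCΘ _
    have h2 : |fderiv ℝ ρ p.1 (M p.2.2 p.1)| ≤ K * (‖fderiv ℝ ρ p.1‖ * ‖p.1‖) := by
      rw [← Real.norm_eq_abs]
      calc ‖fderiv ℝ ρ p.1 (M p.2.2 p.1)‖ ≤ ‖fderiv ℝ ρ p.1‖ * ‖M p.2.2 p.1‖ :=
            ContinuousLinearMap.le_opNorm _ _
        _ ≤ ‖fderiv ℝ ρ p.1‖ * (K * ‖p.1‖) := by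
            gcongr
            exact (M p.2.2).le_of_opNorm_le (hMK _) _
        _ = K * (‖fderiv ℝ ρ p.1‖ * ‖p.1‖) := by ring
    calc |Θ (p.2.2.1, p.2.2.2 - Torus.proj ((p.2.1 * ε) • p.1))| * |fderiv ℝ ρ p.1 (M p.2.2 p.1)|
        ≤ CΘ * (K * (‖fderiv ℝ ρ p.1‖ * ‖p.1‖)) :=
          mul_le_mul h1 h2 (abs_nonneg _) hCΘ0
      _ = CΘ * K * (‖fderiv ℝ ρ p.1‖ * ‖p.1‖) := by ring
  have hΦi : ∀ ε, Integrable (Φ ε) PP := fun ε =>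
    hBi.mono' (hΦm ε).aestronglyMeasurable (ae_of_all _ (hΦB ε))
  have hΦ0 : ∀ ε p, 0 ≤ Φ ε p := fun ε p => mul_nonneg (hΘ0 _) (abs_nonneg _)
  /- Step 1: the `ℝ≥0∞` chain `‖I_ε‖ₑ ≤ ofReal (Mbd² ∫ Φ ε dPP)` for `ε > 0` -/
  have hchain : ∀ ε : ℝ, 0 < ε →
      |∫ t in Ioo 0 T, ∫ x, Torus.duchonRobertApprox ρ ε (w t) x * θ t x| ≤
        Mbd ^ 2 * ∫ p, Φ ε p ∂PP := by
    intro ε hε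
    have hρε : FluidPDE.IsMollifier (FluidPDE.mollifierScale ε ρ) := hρ.mollifierScale hε
    have hgc := Torus.continuous_gradient_mollifierScale hρ hε
    -- the joint integrand on `(ℝ × T^d) × ℝ^d`
    set g : (ℝ × UnitAddTorus d) × EuclideanSpace ℝ d → ℝ≥0∞ := fun r =>
      ‖⟪gradient (FluidPDE.mollifierScale ε ρ) r.2, Torus.increment (w r.1.1) r.2 r.1.2⟫‖ₑ *
        ‖θ r.1.1 r.1.2‖ₑ with hg
    have hgm : Measurable g := by
      refine Measurable.mul ?_ (hθc.measurable.comp measurable_fst).enorm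
      refine (Measurable.inner (hgc.measurable.comp measurable_snd) ?_).enorm
      simp only [Torus.increment]
      refine Measurable.sub ?_ (hw.measurable.comp measurable_fst)
      exact hw.measurable.comp ((measurable_fst.comp measurable_fst).prodMk
        ((measurable_snd.comp measurable_fst).add (Torus.measurable_proj.comp measurable_snd)))
    -- (a) `‖I_ε‖ₑ ≤ Mbd² ∫⁻ ξ ∫⁻ q g`
    have ha : ‖∫ t in Ioo 0 T, ∫ x, Torus.duchonRobertApprox ρ ε (w t) x * θ t x‖ₑ ≤
        ENNReal.ofReal (Mbd ^ 2) * ∫⁻ ξ, ∫⁻ q, g (q, ξ) := by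
      calc ‖∫ t in Ioo 0 T, ∫ x, Torus.duchonRobertApprox ρ ε (w t) x * θ t x‖ₑ
          ≤ ∫⁻ t in Ioo 0 T, ‖∫ x, Torus.duchonRobertApprox ρ ε (w t) x * θ t x‖ₑ :=
            enorm_integral_le_lintegral_enorm _
        _ ≤ ∫⁻ t, ‖∫ x, Torus.duchonRobertApprox ρ ε (w t) x * θ t x‖ₑ :=
            lintegral_mono' Measure.restrict_le_self le_rfl
        _ ≤ ∫⁻ t, ∫⁻ x, ENNReal.ofReal (Mbd ^ 2) * ∫⁻ ξ, g ((t, x), ξ) := by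
            refine lintegral_mono fun t => (enorm_integral_le_lintegral_enorm _).trans
              (lintegral_mono fun x => ?_)
            rw [enorm_mul]
            calc ‖Torus.duchonRobertApprox ρ ε (w t) x‖ₑ * ‖θ t x‖ₑ
                ≤ (ENNReal.ofReal (Mbd ^ 2) * ∫⁻ ξ, ‖⟪gradient (FluidPDE.mollifierScale ε ρ) ξ,
                    Torus.increment (w t) ξ x⟫‖ₑ) * ‖θ t x‖ₑ := by
                  gcongr
                  exact enorm_duchonRobertApprox_le_structure ρ ε (hwb t) x
              _ = ENNReal.ofReal (Mbd ^ 2) * ∫⁻ ξ, g ((t, x), ξ) := by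
                  rw [mul_assoc, ← lintegral_mul_const' _ _ enorm_ne_top]
        _ = ENNReal.ofReal (Mbd ^ 2) * ∫⁻ t, ∫⁻ x, ∫⁻ ξ, g ((t, x), ξ) := by
            simp_rw [lintegral_const_mul' _ _ ENNReal.ofReal_ne_top]
        _ = ENNReal.ofReal (Mbd ^ 2) * ∫⁻ q : ℝ × UnitAddTorus d, ∫⁻ ξ, g (q, ξ) := by
            congr 1
            rw [Measure.volume_eq_prod, lintegral_prod _ (hgm.lintegral_prod_right').aemeasurable]
        _ = ENNReal.ofReal (Mbd ^ 2) * ∫⁻ ξ, ∫⁻ q, g (q, ξ) := by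
            rw [lintegral_lintegral_swap hgm.aemeasurable]
    -- (b) at fixed `ξ`: the dualised increment estimate
    have hb : ∀ ξ, ∫⁻ q, g (q, ξ) ≤ ENNReal.ofReal (∫ s in Icc (0 : ℝ) 1, ∫ q,
        Θ (q.1, q.2 - Torus.proj (s • ξ)) * |⟪gradient (FluidPDE.mollifierScale ε ρ) ξ, M q ξ⟫| ∂μ) := by
      intro ξ
      set e : EuclideanSpace ℝ d := gradient (FluidPDE.mollifierScale ε ρ) ξ with he
      -- `F = ζ ⟪e, δ_ξ w⟫`
      set F : ℝ × UnitAddTorus d → ℝ := fun q =>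
        ζ q.1 * ⟪e, w q.1 (q.2 + Torus.proj ξ) - w q.1 q.2⟫ with hF
      have hFm : AEStronglyMeasurable F volume := by
        have h1 : StronglyMeasurable fun q : ℝ × UnitAddTorus d =>
            ⟪e, w q.1 (q.2 + Torus.proj ξ) - w q.1 q.2⟫ :=
          (continuous_const.inner continuous_id).comp_stronglyMeasurable
            ((hw.comp_measurable (measurable_fst.prodMk (measurable_snd.add_const _))).sub hw)
        exact ((hζc.comp continuous_fst).stronglyMeasurable.mul h1).aestronglyMeasurable
      have hFi : Integrable F volume := by
        refine integrable_of_bound_of_time_support (a := a) (b := b) hFm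
          (C := 1 * (‖e‖ * (Mbd + Mbd))) (fun q => ?_) fun q hq => by
            simp only [hF, hζ0 q.1 hq, zero_mul]
        rw [hF, norm_mul]
        refine mul_le_mul (by rw [Real.norm_eq_abs]; exact hζ1 q.1) ?_ (norm_nonneg _) zero_le_one
        refine (norm_inner_le_norm _ _).trans (mul_le_mul_of_nonneg_left ?_ (norm_nonneg _))
        exact (norm_sub_le _ _).trans (add_le_add (hwb _ _) (hwb _ _))
      have hFΘi : Integrable (fun q => |F q| * Θ q) volume :=
        hFi.abs.mul_bdd hΘc.aestronglyMeasurable (ae_of_all _ hCΘ)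
      -- pointwise: `g (q, ξ) ≤ ofReal (|F q| Θ q)`
      have hpt : ∀ q, g (q, ξ) ≤ ENNReal.ofReal (|F q| * Θ q) := by
        intro q
        simp only [hg, hF, Torus.increment]
        by_cases hq : q.1 ∈ Icc a' b'
        · rw [hζone q.1 hq, one_mul, Real.enorm_eq_ofReal_abs, Real.enorm_eq_ofReal_abs,
            ← ENNReal.ofReal_mul (abs_nonneg _)]
          exact ENNReal.ofReal_le_ofReal (mul_le_mul_of_nonneg_left (hθΘ _ _) (abs_nonneg _))
        · rw [hθsupp q.1 hq]
          simp
      calc ∫⁻ q, g (q, ξ) ≤ ∫⁻ q, ENNReal.ofReal (|F q| * Θ q) := lintegral_mono hpt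
        _ = ENNReal.ofReal (∫ q, |F q| * Θ q) :=
            (ofReal_integral_eq_lintegral_ofReal hFΘi (ae_of_all _ fun q =>
              mul_nonneg (abs_nonneg _) (hΘ0 q))).symm
        _ ≤ _ := by
            refine ENNReal.ofReal_le_ofReal ?_
            have h := integral_abs_inner_increment_mul_le hw hwb hζc hζ1 hζ0 hM hMK hrep hΘc hΘs hΘ0
              e ξ one_pos
            simp only [one_smul, mul_one, one_mul] at h
            exact h
    -- (c) change variables `ξ = εz`
    have hc : ∫⁻ ξ, ENNReal.ofReal (∫ s in Icc (0 : ℝ) 1, ∫ q,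
        Θ (q.1, q.2 - Torus.proj (s • ξ)) * |⟪gradient (FluidPDE.mollifierScale ε ρ) ξ, M q ξ⟫| ∂μ) =
        ∫⁻ z, ENNReal.ofReal (∫ s in Icc (0 : ℝ) 1, ∫ q,
          Θ (q.1, q.2 - Torus.proj ((s * ε) • z)) * |fderiv ℝ ρ z (M q z)| ∂μ) := by
      rw [lintegral_eq_mul_lintegral_comp_smul _ hε, ← lintegral_const_mul' _ _ ENNReal.ofReal_ne_top]
      refine lintegral_congr fun z => ?_
      rw [← ENNReal.ofReal_mul (pow_pos hε _).le]
      congr 1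
      simp_rw [inner_gradient_mollifierScale_smul hρd hε.ne', abs_mul,
        abs_of_pos (inv_pos.2 (pow_pos hε _)), smul_smul]
      have : ∀ s : ℝ, ∫ q, Θ (q.1, q.2 - Torus.proj ((s * ε) • z)) *
          ((ε ^ Fintype.card d)⁻¹ * |fderiv ℝ ρ z (M q z)|) ∂μ =
          (ε ^ Fintype.card d)⁻¹ * ∫ q, Θ (q.1, q.2 - Torus.proj ((s * ε) • z)) *
            |fderiv ℝ ρ z (M q z)| ∂μ := by
        intro s
        rw [← integral_const_mul]
        refine integral_congr_ae (ae_of_all _ fun q => ?_)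
        ring
      simp_rw [this, integral_const_mul, ← mul_assoc, mul_inv_cancel₀ (pow_pos hε _).ne', one_mul]
    -- (d) the `z`-integral is `∫ Φ ε dPP`
    have hW : ∀ z, ∫ s in Icc (0 : ℝ) 1, ∫ q,
        Θ (q.1, q.2 - Torus.proj ((s * ε) • z)) * |fderiv ℝ ρ z (M q z)| ∂μ = ∫ r, Φ ε (z, r) ∂π := by
      intro z
      have hint : Integrable (fun r => Φ ε (z, r)) π := by
        refine Integrable.of_bound ((hΦm ε).comp (measurable_const.prodMk measurable_id)
          |>.aestronglyMeasurable) (B (z, (0, (0, 0)))) (ae_of_all _ fun r => ?_)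
        have := hΦB ε (z, r)
        simpa only [hB] using this
      rw [hπ, integral_prod _ hint]
    have hd : ∫⁻ z, ENNReal.ofReal (∫ s in Icc (0 : ℝ) 1, ∫ q,
        Θ (q.1, q.2 - Torus.proj ((s * ε) • z)) * |fderiv ℝ ρ z (M q z)| ∂μ) =
        ENNReal.ofReal (∫ p, Φ ε p ∂PP) := by
      simp_rw [hW]
      rw [hPP, integral_prod _ (hΦi ε), ofReal_integral_eq_lintegral_ofReal]
      · exact (hΦi ε).integral_prod_left
      · exact ae_of_all _ fun z => integral_nonneg fun r => hΦ0 ε _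
    -- (e) combine
    have htot : ‖∫ t in Ioo 0 T, ∫ x, Torus.duchonRobertApprox ρ ε (w t) x * θ t x‖ₑ ≤
        ENNReal.ofReal (Mbd ^ 2 * ∫ p, Φ ε p ∂PP) := by
      rw [ENNReal.ofReal_mul (sq_nonneg _), ← hd, ← hc]
      refine ha.trans ?_
      gcongr with ξ
      exact hb ξ
    have hnn : 0 ≤ Mbd ^ 2 * ∫ p, Φ ε p ∂PP :=
      mul_nonneg (sq_nonneg _) (integral_nonneg fun p => hΦ0 ε p)
    rw [← Real.norm_eq_abs, ← toReal_enorm, ← ENNReal.toReal_ofReal hnn]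
    exact ENNReal.toReal_mono ENNReal.ofReal_ne_top htot
  /- Step 2: `ε → 0⁺` by dominated convergence -/
  have hDCT : Tendsto (fun ε => ∫ p, Φ ε p ∂PP) (𝓝[>] 0) (𝓝 (∫ p, Φ 0 p ∂PP)) := by
    refine tendsto_integral_filter_of_dominated_convergence B
      (Eventually.of_forall fun ε => (hΦm ε).aestronglyMeasurable)
      (Eventually.of_forall fun ε => ae_of_all _ (hΦB ε)) hBi (ae_of_all _ fun p => ?_)
    refine tendsto_nhdsWithin_of_tendsto_nhds ?_
    have hcont : Continuous fun ε : ℝ => Φ ε p := by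
      simp only [hΦ]
      refine (hΘc.comp (continuous_const.prodMk (continuous_const.sub
        (Torus.continuous_proj.comp ((continuous_const.mul continuous_id).smul
          continuous_const))))).mul continuous_const
    exact hcont.tendsto 0
  /- Step 3: the limit integral -/
  have hlimit : ∫ p, Φ 0 p ∂PP = ∫ q, (∫ z, |fderiv ℝ ρ z (M q z)|) * Θ q ∂μ := by
    have h0 : ∀ p, Φ 0 p = Θ p.2.2 * |fderiv ℝ ρ p.1 (M p.2.2 p.1)| := by
      intro p
      simp only [hΦ, mul_zero, zero_smul, Torus.proj_zero, sub_zero, Prod.mk.eta]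
    -- inner integral over `π`: the `s`-average is trivial
    have hinner : ∀ z, ∫ r, Φ 0 (z, r) ∂π = ∫ q, Θ q * |fderiv ℝ ρ z (M q z)| ∂μ := by
      intro z
      have hint : Integrable (fun r => Φ 0 (z, r)) π := by
        refine Integrable.of_bound ((hΦm 0).comp (measurable_const.prodMk measurable_id)
          |>.aestronglyMeasurable) (B (z, (0, (0, 0)))) (ae_of_all _ fun r => ?_)
        have := hΦB 0 (z, r)
        simpa only [hB] using this
      rw [hπ, integral_prod _ hint]
      simp only [h0]
      rw [setIntegral_const, Real.volume_real_Icc_of_le zero_le_one, sub_zero, one_smul]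
    rw [hPP, integral_prod _ (hΦi 0)]
    simp_rw [hinner]
    -- swap `z` and `q`
    have hswap : Integrable (uncurry fun (z : EuclideanSpace ℝ d) (q : ℝ × UnitAddTorus d) =>
        Θ q * |fderiv ℝ ρ z (M q z)|) ((volume : Measure (EuclideanSpace ℝ d)).prod μ) := by
      have hmeas : Measurable (uncurry fun (z : EuclideanSpace ℝ d) (q : ℝ × UnitAddTorus d) =>
          Θ q * |fderiv ℝ ρ z (M q z)|) := by
        refine (hΘc.measurable.comp measurable_snd).mul ?_
        refine (measurable_dual_apply₂ ((hρ1.continuous_fderiv one_ne_zero).measurable.comp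
          measurable_fst) ?_).abs
        exact measurable_clm_apply₂ (hM.measurable.comp measurable_snd) measurable_fst
      refine Integrable.mono' (((integrable_norm_fderiv_mul_norm hρ1 hρ.2.1).const_mul
        (CΘ * K)).mul_prod (integrable_const (1 : ℝ))) hmeas.aestronglyMeasurable
        (ae_of_all _ fun p => ?_)
      have := hΦB 0 (p.1, (0, p.2))
      simp only [hΦ, hB, mul_zero, zero_smul, Torus.proj_zero, sub_zero, Prod.mk.eta] at this
      simpa only [uncurry, hB] using this
    rw [integral_integral_swap hswap]
    refine integral_congr_ae (ae_of_all _ fun q => ?_)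
    simp only
    rw [integral_const_mul, mul_comm]
  /- Step 4: conclude -/
  have h1 : Tendsto (fun ε => |∫ t in Ioo 0 T, ∫ x, Torus.duchonRobertApprox ρ ε (w t) x * θ t x|)
      (𝓝[>] 0) (𝓝 |D θ|) := hlim.abs
  have h2 : Tendsto (fun ε => Mbd ^ 2 * ∫ p, Φ ε p ∂PP) (𝓝[>] 0)
      (𝓝 (Mbd ^ 2 * ∫ q, (∫ z, |fderiv ℝ ρ z (M q z)|) * Θ q ∂μ)) := by
    rw [← hlimit]
    exact hDCT.const_mul _
  exact le_of_tendsto_of_tendsto h1 h2 (eventually_nhdsWithin_of_forall fun ε hε => hchain ε hε)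

end FluxBound

end CodimensionOneRigidity

end Literature.Barriers.AnomalousDissipation

end
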